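import Summits.MatrixMultiplication.OmegaCensus.DominoZpZpCells
import Summits.MatrixMultiplication.OmegaCensus.DominoZpZpStructFour
import Summits.MatrixMultiplication.OmegaCensus.DominoZ17Z17Cells
import Summits.MatrixMultiplication.OmegaCensus.DominoZ17StructFourTableA
import HarnessLib

/-!
# No domino cube law with a part of size `4` over any `A ↠ ℤ_17 × ℤ_17` (structural route)

ω-census `pub-omega`, family (b3), seat pub-omega-group gen 22.  Framing: lottery ticket; floor = certified bounds/negative
ranges.  VALUE: kernel theorems of the `ℤ_p²`-quotient column (`p = 17`) of the Dih-side mod-one classification — the census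
cell `(1,4,24)@289` and every larger order, any `c₀` — by the STRUCTURAL part-`4` route `DominoZpZpStructFour.lean` (no kernel
enumeration of value functions): the certified table `tableZ17s4` of the 162 normalised repeated count vectors, its key tree,
the `checkFour` completeness decide, `exists_entry_structFour`, and the generic cell theorems of `DominoZpZpCells.lean`
(half `η = 9`: `9 + 9 = 1` in `ZMod 17`); NOT progress on ω.

* `exists_table_entry_17_4s` — the scaled cover hypothesis for `d = 4`;
* `no_law_cube_14e_of_onto_z17z17` / `no_law_cube_1d4_of_onto_z17z17` — the cells.
-/

namespace Summit.MatrixMultiplication.OmegaCensus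

open Finset ZpZpDomino Literature.Combinatorics.Additive

namespace ZpZpDomino

/-- The certified table of the structural part-`4` route for `p = 17` (1 file(s), 162 entries, increasing codes). [folklore] -/
noncomputable def tableZ17s4 : List (List ℕ × List (ℕ × List ℕ)) := tableZ17s4a

/-- Every entry of `tableZ17s4` is a valid certificate. [folklore] -/
theorem tableZ17s4_cert : ∀ e ∈ tableZ17s4, lineCert 17 (vecFn e.1) e.2 = true := by
  simpa [tableZ17s4] using tableZ17s4a_cert

/-- Key tree of `tableZ17s4` (codes `polyBE 5`, balanced build). [folklore] -/
noncomputable def tabTreeZ17s4 : BTree := tabTree 5 162 tableZ17s4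

set_option maxHeartbeats 4000000 in
/-- The keys are well formed (length `17`, digits `< 5`). [folklore] -/
theorem tableZ17s4_wf : tabWF 17 5 tableZ17s4 = true := by decide +kernel

set_option maxHeartbeats 4000000 in
/-- **Completeness**: the key tree contains the count vector of every normalised repeated quadruple (`17² + 17 + 2` lookups).
[folklore] -/
theorem checkFour_17 : checkFour 17 tabTreeZ17s4 = true := by decide +kernel

/-- **Every value function of sum `4` on `ZMod 17 × ZMod 17` (as `289` values) has a line direction whose count vector is,
up to a unit scaling of `ZMod 17`, a certified entry of `tableZ17s4`** (structural route; the normal-form clause is unused).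
[folklore] -/
theorem exists_table_entry_17_4s (g : Fin (17 * 17) → ℕ) (hg : ∑ i, g i = 4)
    (_hNF : (1 ≤ g ⟨17, by decide⟩ ∧ 1 ≤ g ⟨1, by decide⟩) ∨
      (1 ≤ g ⟨17, by decide⟩ ∧ ∀ i : Fin (17 * 17), i.val % 17 ≠ 0 → g i = 0) ∨ (∀ i : Fin (17 * 17), i.val ≠ 0 → g i = 0)) :
    ∃ j < 17 + 1, ∃ k : ℕ, k % 17 ≠ 0 ∧ ∃ e ∈ tableZ17s4, ∀ v < 17,
      e.1.getD (k * v % 17) 0 = ∑ i : Fin (17 * 17), pick v (pv 17 j i.val) (g i) :=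
  haveI : Fact (Nat.Prime 17) := ⟨by decide⟩
  exists_entry_structFour (by decide) tableZ17s4 tabTreeZ17s4 (fun _ h => mem_tabTree h) tableZ17s4_wf checkFour_17 g hg

end ZpZpDomino

variable {A : Type} [AddCommGroup A] [DecidableEq A] [Fintype A] {G : Type} [Group G] [DecidableEq G]
  {ρ τ : A → G} {c₀ : A} {S T U : Finset G}

/-- **No `(1,1 | 4,4 | e,e)` law triple over `A ↠ ℤ_17 × ℤ_17`**: dihedral-like `G` over `A` (any `c₀`), `φ` onto, TPP triple
with coset parts `|S₀| = |S₁| = 1`, `|T₀| = |T₁| = 4`, `|U₀| = |U₁|` ⇒ `3|S||T||U| + 8 ≠ 8|A|` — census cell `(1,4,24)@289`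
and all larger orders. [folklore] -/
theorem no_law_cube_14e_of_onto_z17z17
    (hρρ : ∀ a b, ρ a * ρ b = ρ (a + b)) (hρτ : ∀ a b, ρ a * τ b = τ (b - a))
    (hτρ : ∀ a b, τ a * ρ b = τ (a + b)) (hττ : ∀ a b, τ a * τ b = ρ (c₀ + b - a))
    (hρ : Function.Injective ρ) (hτ : Function.Injective τ) (hne : ∀ a b, ρ a ≠ τ b)
    (hsurj : ∀ g, (∃ a, ρ a = g) ∨ (∃ a, τ a = g))
    (φ : A →+ ZMod 17 × ZMod 17) (hφ : Function.Surjective φ)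
    (h : TripleProductProperty S T U)
    (hS₀ : (univ.filter fun a : A => ρ a ∈ S).card = 1) (hS₁ : (univ.filter fun a : A => τ a ∈ S).card = 1)
    (hT₀ : (univ.filter fun a : A => ρ a ∈ T).card = 4) (hT₁ : (univ.filter fun a : A => τ a ∈ T).card = 4)
    (hU : (univ.filter fun a : A => ρ a ∈ U).card = (univ.filter fun a : A => τ a ∈ U).card)
    (hV : 3 * (S.card * T.card * U.card) + 8 = 8 * Fintype.card A) : False :=
  haveI : Fact (Nat.Prime 17) := ⟨by decide⟩
  no_law_cube_1de_of_onto_zpzp_of_cover (9 : ZMod 17) half_zmod17 tableZ17s4 tableZ17s4_cert ⟨17, by decide⟩ ⟨1, by decide⟩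
    rfl rfl exists_table_entry_17_4s hρρ hρτ hτρ hττ hρ hτ hne hsurj φ hφ h hS₀ hS₁ hT₀ hT₁ hU hV

/-- **No `(1,1 | d,d | 4,4)` law triple over `A ↠ ℤ_17 × ℤ_17`** (the part `4` in `U`). [folklore] -/
theorem no_law_cube_1d4_of_onto_z17z17
    (hρρ : ∀ a b, ρ a * ρ b = ρ (a + b)) (hρτ : ∀ a b, ρ a * τ b = τ (b - a))
    (hτρ : ∀ a b, τ a * ρ b = τ (a + b)) (hττ : ∀ a b, τ a * τ b = ρ (c₀ + b - a))
    (hρ : Function.Injective ρ) (hτ : Function.Injective τ) (hne : ∀ a b, ρ a ≠ τ b)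
    (hsurj : ∀ g, (∃ a, ρ a = g) ∨ (∃ a, τ a = g))
    (φ : A →+ ZMod 17 × ZMod 17) (hφ : Function.Surjective φ)
    (h : TripleProductProperty S T U)
    (hS₀ : (univ.filter fun a : A => ρ a ∈ S).card = 1) (hS₁ : (univ.filter fun a : A => τ a ∈ S).card = 1)
    (hT : (univ.filter fun a : A => ρ a ∈ T).card = (univ.filter fun a : A => τ a ∈ T).card)
    (hU₀ : (univ.filter fun a : A => ρ a ∈ U).card = 4) (hU₁ : (univ.filter fun a : A => τ a ∈ U).card = 4)
    (hV : 3 * (S.card * T.card * U.card) + 8 = 8 * Fintype.card A) : False :=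
  haveI : Fact (Nat.Prime 17) := ⟨by decide⟩
  no_law_cube_1d_e_of_onto_zpzp_of_cover (9 : ZMod 17) half_zmod17 tableZ17s4 tableZ17s4_cert ⟨17, by decide⟩ ⟨1, by decide⟩
    rfl rfl exists_table_entry_17_4s hρρ hρτ hτρ hττ hρ hτ hne hsurj φ hφ h hS₀ hS₁ hT hU₀ hU₁ hV

end Summit.MatrixMultiplication.OmegaCensus
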